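/-
Copyright (c) 2026. All rights reserved.
Released under Apache 2.0 license as described in the file LICENSE.
Authors: abc-iut cell, wave-6 cone prover seat abc-iut-w6-d025 (gen 5; L4-lead m151 (4) row «TWO-SIDED-SUM»), over
abc-iut-L4-t3's §5 interface (`LogFrobeniusCompatibility.lean`, `LogFrobeniusMonoAnalyticization.lean`,
`LogFrobeniusIotaAnMono.lean`); successor of this seat's `LogFrobeniusSettingProd.lean` (gen 4).
-/
import Literature.AnabelianGeometry.AbsoluteAnabelian.Ltimes.LogFrobeniusIotaAnMono
import Mathlib.CategoryTheory.Category.Cat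
import Literature.AnabelianGeometry.AbsoluteAnabelian.LogFrobeniusSettingSum
import HarnessLib

/-!
# [AbsTopIII] Def 5.4 / 5.6 / Prop 5.8 (vii): the SUM of two log-Frobenius settings over a disjoint union of index sets
# (global categories = products; at each place ONLY its own factor's local row, the other factor carried as global data)

S. Mochizuki, *Topics in absolute anabelian geometry III*, J. Math. Sci. Univ. Tokyo 22 (2015) [MochizukiAbsTopIII2015];
manuscript `paper:url-5493eb38cbb7`: Def 5.4 (ii) p. 125 (the GLOBAL categories `Th•_T[Z]`, `Th•[Z]`), (iv) p. 127 ("`𝒩⊞_v`, `𝒩_v`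
… that "lie over" `Th•[Z]`, for each vertex `ν` of `Γ⃗^log_v`" — an object of `𝒩_v` is a GLOBAL object together with LOCAL data
AT `v`), (vii) p. 128, Def 5.6 (ii)–(iv) pp. 135–136, Prop 5.8 (vii) pp. 141–142 ("`w ∈ W_non` (respectively, `w ∈ W_arc`)";
`An⊢[𝒩⊢⊞] := ∏_v An⊢[𝒩⊢⊞_v]` fibred over `Th⊢[Z]`), Cor 5.10 (iv)(a) p. 147.

## Why (successor of `LogFrobeniusSettingProd.lean`, removing its honest limit (P2))

This seat's gen-4 `LogFrobeniusSetting.prod Lt₁ Lt₂` multiplies two settings over the SAME index set: at every place both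
factors' local rows are present, so at a nonarchimedean place the archimedean factor contributes a FILLER slot and
conversely (limit (P2)), and a coherence datum for the product needs BOTH factors coherent at EVERY place — which the
one-place-type genuine models never are at the other type's places.  Print's shape is different: `V(F_mod) = V^non ⊔ V^arc`,
the categories `Th•_T[Z]`, `ℰ•`, `An•`, `ℰ⊢`, `An⊢` are GLOBAL, and `𝒩⊞_v`, `𝒩_v`, `𝒩⊢⊞_v` carry local data AT `v` ONLY.  This
file builds exactly that:

* ★ `LogFrobeniusSetting.sum Lt₁ Lt₂ : LogFrobeniusSetting (V₁ ⊕ V₂) (Sum.elim isArc₁ isArc₂)` for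
  `Lt₁ : LogFrobeniusSetting V₁ isArc₁`, `Lt₂ : LogFrobeniusSetting V₂ isArc₂`: global categories and equivalences the PRODUCTS
  (`𝒳 = 𝒳₁ × 𝒳₂`, `ℰ• = ℰ₁ × ℰ₂`, `An•`, `ℰ⊢`, `An⊢` likewise); at a place `inl v` the local categories are
  `𝒩⊞_{inl v} := Lt₁.𝒩⊞_v × 𝒳₂`, `𝒩_{inl v} := Lt₁.𝒩_v × 𝒳₂`, `𝒩⊢⊞_{inl v} := Lt₁.𝒩⊢⊞_v × ℰ⊢₂`, `𝒩⊢_{inl v} := Lt₁.𝒩⊢_v × ℰ⊢₂`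
  (the OTHER factor's global object rides along unchanged), with `λ⊞ = λ₁ × 𝟭`, `forget = forget₁ × 𝟭`,
  `toE = toE₁ × proj₂`, `ι⊞ = ι₁ × (Λ ⟶ 𝟭)` (`twistToId`: the identity at a pre-log source, `logIsoId` at the post-log source),
  `monoNplus = monoNplus₁ × (proj₂ ⋙ monoAn₂)`, `ψ^{An⊢⊞} = ψ₁ × κ₂⁻¹`; symmetrically at `inr v`.  NO placeholder row anywhere;
* `sumMonoAnalyticizationHomotopies`, `sum_cor510MonoCores` (Cor 5.10 (iv)(a) for the sum from the factors' homotopies),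
  `sumψOverIso`, `sumIotaAnMono` (abc-iut-L4-t3's `ι^{An⊢⊞}` add-on inherited componentwise: `ι₁ × 𝟙`).

The Sum-indexed local categories are packaged as objects of Mathlib's `Cat` (`sumNplusCat`, …) so that NO instance is
declared in this file.  Consumer: `LogFrobeniusSettingSumCoherence.lean` (the coherence add-on of the sum from the factors'
coherence SEPARATELY — each over its own index set —, pinned Cor 5.10 (iv)(b)(c), the `η⊢`-square, and the genuine instances).

HONEST LIMITS (named): (P1) a sum of a one-prime nonarchimedean model and a one-field-functor archimedean model is still a
two-factor PROXY of the global theater, not a category of global Θ-data; (P3) the factors' own limits persist.  (P2) of the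
product file is GONE.  MODEL-LEVEL; refereed pre-IUT material; nothing here bears on [IUTchIII] Cor. 3.12; no side taken;
typed ≠ proved elsewhere.

**`⋉`-TWIN** (cell row «LTIMES-SUM-CARRIER», L4-lead m184; abc-iut-L4-t8 g12): verbatim re-elaboration of `LogFrobeniusSettingSum.lean` (abc-iut-w6-d025)
over `LogFrobeniusSettingLtimes` by the cell recipe `LTIMES-RECIPE.md` (names in `namespace LogFrobeniusSettingLtimes`, factors `Lt₁`, `Lt₂`;
`sumIota` now ranges over `LogEdgeLtimes`, i.e. the edges of `Γ⃗^⋉_v`); statements and proofs otherwise unchanged; the original stays as it is.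
-/

set_option autoImplicit false

noncomputable section

open CategoryTheory

universe u

namespace Literature.AnabelianGeometry.AbsoluteAnabelian

namespace LogFrobeniusSettingLtimes

/-! ## §0. The twist-to-identity transformation -/

section Twist

variable {Vmod : Type u} {isArc : Vmod → Bool} (Lt : LogFrobeniusSettingLtimes Vmod isArc)

/-- `Λ_ν ⟶ 𝟭`: the identity at a pre-log vertex (`Λ_ν = 𝟭`), `logIsoId : log ≅ 𝟭` at the post-log vertex (`Λ_ν = log`) — the
canonical identification used to let the OTHER factor's global object ride along an `ι⊞` of this factor.
[cite: MochizukiAbsTopIII2015, Def 5.4 (vii) p. 128] -/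
def twistToId : (c : Bool) → (frobeniusTwist Lt.log c ⟶ 𝟭 Lt.X)
  | false => 𝟙 (𝟭 Lt.X)
  | true => Lt.logIsoId.hom

/-- At a pre-log source the transformation is the identity. [cite: MochizukiAbsTopIII2015, Def 5.4 (vii) p. 128] -/
@[simp] theorem twistToId_false : Lt.twistToId false = 𝟙 (𝟭 Lt.X) := rfl

/-- At the post-log source it is `logIsoId`. [cite: MochizukiAbsTopIII2015, Def 5.4 (vii) p. 128] -/
@[simp] theorem twistToId_true : Lt.twistToId true = Lt.logIsoId.hom := rfl

/-- Its components are isomorphisms. [cite: MochizukiAbsTopIII2015, Def 5.4 (vii) p. 128] -/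
theorem isIso_twistToId (c : Bool) : IsIso (Lt.twistToId c) := by
  cases c
  · exact IsIso.id _
  · exact Iso.isIso_hom _

end Twist

/-! ## §1. The Sum-indexed local categories (as objects of `Cat`, so that no instance is declared) -/

section Local

variable {V₁ V₂ : Type u} {isArc₁ : V₁ → Bool} {isArc₂ : V₂ → Bool}
  (Lt₁ : LogFrobeniusSettingLtimes V₁ isArc₁) (Lt₂ : LogFrobeniusSettingLtimes V₂ isArc₂)

/-- `𝒩⊞_v` of the sum: `Lt₁.𝒩⊞_v × 𝒳₂` at `inl v`, `𝒳₁ × Lt₂.𝒩⊞_v` at `inr v` (a global object of the other factor rides along).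
[cite: MochizukiAbsTopIII2015, Def 5.4 (iv) p. 127] -/
def sumNplusCat : V₁ ⊕ V₂ → Cat.{u, u + 1}
  | .inl v => Cat.of (Lt₁.Nplus v × Lt₂.X)
  | .inr v => Cat.of (Lt₁.X × Lt₂.Nplus v)

/-- `𝒩_v` of the sum. [cite: MochizukiAbsTopIII2015, Def 5.4 (iv) p. 127] -/
def sumNCat : V₁ ⊕ V₂ → Cat.{u, u + 1}
  | .inl v => Cat.of (Lt₁.N v × Lt₂.X)
  | .inr v => Cat.of (Lt₁.X × Lt₂.N v)

/-- `𝒩⊢⊞_w` of the sum: `Lt₁.𝒩⊢⊞_w × ℰ⊢₂` at `inl w`, `ℰ⊢₁ × Lt₂.𝒩⊢⊞_w` at `inr w`. [cite: MochizukiAbsTopIII2015, Def 5.6 (iv) p. 136] -/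
def sumNmonoPlusCat : V₁ ⊕ V₂ → Cat.{u, u + 1}
  | .inl w => Cat.of (Lt₁.NmonoPlus w × Lt₂.Emono)
  | .inr w => Cat.of (Lt₁.Emono × Lt₂.NmonoPlus w)

/-- `𝒩⊢_w` of the sum. [cite: MochizukiAbsTopIII2015, Def 5.6 (iv) p. 136] -/
def sumNmonoCat : V₁ ⊕ V₂ → Cat.{u, u + 1}
  | .inl w => Cat.of (Lt₁.Nmono w × Lt₂.Emono)
  | .inr w => Cat.of (Lt₁.Emono × Lt₂.Nmono w)

/-- `𝒩⊞_v → 𝒩_v`: `forget₁ × 𝟭` resp. `𝟭 × forget₂`. [cite: MochizukiAbsTopIII2015, Def 5.4 (iv) p. 127] -/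
def sumForget : (v : V₁ ⊕ V₂) → (sumNplusCat Lt₁ Lt₂ v ⥤ sumNCat Lt₁ Lt₂ v)
  | .inl v => (Lt₁.forget v).prod (𝟭 Lt₂.X)
  | .inr v => (𝟭 Lt₁.X).prod (Lt₂.forget v)

/-- `𝒩_v → ℰ•`: `toE₁ × proj₂` resp. `proj₁ × toE₂` (the carried global object is projected to `ℰ•` here).
[cite: MochizukiAbsTopIII2015, Def 5.4 (iv) p. 127] -/
def sumToE : (v : V₁ ⊕ V₂) → (sumNCat Lt₁ Lt₂ v ⥤ Lt₁.E × Lt₂.E)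
  | .inl v => (Lt₁.toE v).prod Lt₂.proj
  | .inr v => Lt₁.proj.prod (Lt₂.toE v)

/-- `λ⊞_{v,ν}`: `λ₁ × 𝟭` resp. `𝟭 × λ₂`. [cite: MochizukiAbsTopIII2015, Def 5.4 (iv) p. 127] -/
def sumLam : (v : V₁ ⊕ V₂) → LogVertex (Sum.elim isArc₁ isArc₂ v) → (Lt₁.X × Lt₂.X ⥤ sumNplusCat Lt₁ Lt₂ v)
  | .inl v, ν => (Lt₁.lam v ν).prod (𝟭 Lt₂.X)
  | .inr v, ν => (𝟭 Lt₁.X).prod (Lt₂.lam v ν)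

/-- `λ⊞_{v,ν}` lies over `Th•[Z] = ℰ₁ × ℰ₂`: `lamOver₁ × (𝟭 ⋙ 𝟭 ⋙ proj₂ ≅ proj₂)`. [cite: MochizukiAbsTopIII2015, Def 5.4 (iv) p. 127] -/
def sumLamOver : (v : V₁ ⊕ V₂) → (ν : LogVertex (Sum.elim isArc₁ isArc₂ v)) →
    (sumLam Lt₁ Lt₂ v ν ⋙ sumForget Lt₁ Lt₂ v ⋙ sumToE Lt₁ Lt₂ v ≅ Lt₁.proj.prod Lt₂.proj)
  | .inl v, ν => NatIso.prod (Lt₁.lamOver v ν) (Lt₂.proj.leftUnitor ≪≫ Lt₂.proj.leftUnitor)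
  | .inr v, ν => NatIso.prod (Lt₁.proj.leftUnitor ≪≫ Lt₁.proj.leftUnitor) (Lt₂.lamOver v ν)

/-- The space-link and post-log functors of the sum coincide (factorwise). [cite: MochizukiAbsTopIII2015, Cor 5.5 p. 130] -/
theorem sumLam_spaceLink_eq_postLog : ∀ v : V₁ ⊕ V₂,
    sumLam Lt₁ Lt₂ v (LogVertex.spaceLink (Sum.elim isArc₁ isArc₂ v)) =
      sumLam Lt₁ Lt₂ v (LogVertex.postLog (Sum.elim isArc₁ isArc₂ v))
  | .inl v => congrArg (fun F => F.prod (𝟭 Lt₂.X)) (Lt₁.lam_spaceLink_eq_postLog v)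
  | .inr v => congrArg (fun F => (𝟭 Lt₁.X).prod F) (Lt₂.lam_spaceLink_eq_postLog v)

/-- The source of `ι⊞` in the sum at `inl v`: the twisted global functor composed with `λ₁ × 𝟭` is
`(Λ₁ ⋙ λ₁) × Λ₂`. [cite: MochizukiAbsTopIII2015, Def 5.4 (vii) p. 128] -/
theorem twist_comp_sumLam_inl (c : Bool) (v : V₁) (ν : LogVertex (isArc₁ v)) :
    frobeniusTwist (Lt₁.log.prod Lt₂.log) c ⋙ sumLam Lt₁ Lt₂ (.inl v) ν =
      (frobeniusTwist Lt₁.log c ⋙ Lt₁.lam v ν).prod (frobeniusTwist Lt₂.log c) := by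
  cases c <;> rfl

/-- The same at `inr v`. [cite: MochizukiAbsTopIII2015, Def 5.4 (vii) p. 128] -/
theorem twist_comp_sumLam_inr (c : Bool) (v : V₂) (ν : LogVertex (isArc₂ v)) :
    frobeniusTwist (Lt₁.log.prod Lt₂.log) c ⋙ sumLam Lt₁ Lt₂ (.inr v) ν =
      (frobeniusTwist Lt₁.log c).prod (frobeniusTwist Lt₂.log c ⋙ Lt₂.lam v ν) := by
  cases c <;> rfl

/-- **`ι⊞_{v,ε}` of the sum**: `ι₁ × (Λ₂ ⟶ 𝟭)` at `inl v`, `(Λ₁ ⟶ 𝟭) × ι₂` at `inr v` — the other factor's global object rides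
along through the canonical identification of its twist with the identity. [cite: MochizukiAbsTopIII2015, Def 5.4 (vii) p. 128] -/
def sumIota : (v : V₁ ⊕ V₂) → {ν₁ ν₂ : LogVertex (Sum.elim isArc₁ isArc₂ v)} → LogEdgeLtimes (Sum.elim isArc₁ isArc₂ v) ν₁ ν₂ →
    (frobeniusTwist (Lt₁.log.prod Lt₂.log) ν₁.isPostLog ⋙ sumLam Lt₁ Lt₂ v ν₁ ⟶ sumLam Lt₁ Lt₂ v ν₂)
  | .inl v, ν₁, _, ε => eqToHom (twist_comp_sumLam_inl Lt₁ Lt₂ ν₁.isPostLog v ν₁) ≫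
      NatTrans.prod (Lt₁.iota v ε) (Lt₂.twistToId ν₁.isPostLog)
  | .inr v, ν₁, _, ε => eqToHom (twist_comp_sumLam_inr Lt₁ Lt₂ ν₁.isPostLog v ν₁) ≫
      NatTrans.prod (Lt₁.twistToId ν₁.isPostLog) (Lt₂.iota v ε)

/-- `𝒩⊢⊞_w → 𝒩⊢_w`: `forgetMono₁ × 𝟭` resp. `𝟭 × forgetMono₂`. [cite: MochizukiAbsTopIII2015, Def 5.6 (iv) p. 136] -/
def sumForgetMono : (w : V₁ ⊕ V₂) → (sumNmonoPlusCat Lt₁ Lt₂ w ⥤ sumNmonoCat Lt₁ Lt₂ w)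
  | .inl w => (Lt₁.forgetMono w).prod (𝟭 Lt₂.Emono)
  | .inr w => (𝟭 Lt₁.Emono).prod (Lt₂.forgetMono w)

/-- `𝒩⊢_w → ℰ⊢ = ℰ⊢₁ × ℰ⊢₂`: `toEmono₁ × 𝟭` resp. `𝟭 × toEmono₂`. [cite: MochizukiAbsTopIII2015, Def 5.6 (iv) p. 136] -/
def sumToEmono : (w : V₁ ⊕ V₂) → (sumNmonoCat Lt₁ Lt₂ w ⥤ Lt₁.Emono × Lt₂.Emono)
  | .inl w => (Lt₁.toEmono w).prod (𝟭 Lt₂.Emono)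
  | .inr w => (𝟭 Lt₁.Emono).prod (Lt₂.toEmono w)

/-- `𝒩⊞_v → 𝒩⊢⊞_v`: `monoNplus₁ × (proj₂ ⋙ monoAn₂)` resp. symmetric — the carried global object is mono-analyticised.
[cite: MochizukiAbsTopIII2015, Def 5.6 (iv) p. 136] -/
def sumMonoNplus : (v : V₁ ⊕ V₂) → (sumNplusCat Lt₁ Lt₂ v ⥤ sumNmonoPlusCat Lt₁ Lt₂ v)
  | .inl v => (Lt₁.monoNplus v).prod (Lt₂.proj ⋙ Lt₂.monoAn)
  | .inr v => (Lt₁.proj ⋙ Lt₁.monoAn).prod (Lt₂.monoNplus v)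

/-- `𝒩_v → 𝒩⊢_v`: `monoN₁ × (proj₂ ⋙ monoAn₂)` resp. symmetric. [cite: MochizukiAbsTopIII2015, Def 5.6 (iv) p. 136] -/
def sumMonoN : (v : V₁ ⊕ V₂) → (sumNCat Lt₁ Lt₂ v ⥤ sumNmonoCat Lt₁ Lt₂ v)
  | .inl v => (Lt₁.monoN v).prod (Lt₂.proj ⋙ Lt₂.monoAn)
  | .inr v => (Lt₁.proj ⋙ Lt₁.monoAn).prod (Lt₂.monoN v)

/-- The rows-3→4 homotopy of the sum: `monoHomotopy₁ × (canonical unitors)` resp. symmetric.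
[cite: MochizukiAbsTopIII2015, Def 5.6 (iv) p. 136] -/
def sumMonoHomotopy : (v : V₁ ⊕ V₂) →
    (sumMonoNplus Lt₁ Lt₂ v ⋙ sumForgetMono Lt₁ Lt₂ v ≅ sumForget Lt₁ Lt₂ v ⋙ sumMonoN Lt₁ Lt₂ v)
  | .inl v => NatIso.prod (Lt₁.monoHomotopy v)
      ((Lt₂.proj ⋙ Lt₂.monoAn).rightUnitor ≪≫ ((Lt₂.proj ⋙ Lt₂.monoAn).leftUnitor).symm)
  | .inr v => NatIso.prod ((Lt₁.proj ⋙ Lt₁.monoAn).rightUnitor ≪≫ ((Lt₁.proj ⋙ Lt₁.monoAn).leftUnitor).symm)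
      (Lt₂.monoHomotopy v)

/-- **`ψ^{An⊢⊞}_{w,ν}` of the sum**: `ψ₁ × κ₂⁻¹` at `inl w` (the GENUINE row of the first factor; the second factor's object of
`An⊢` read back in `ℰ⊢₂` through its own equivalence), symmetric at `inr w`. [cite: MochizukiAbsTopIII2015, Prop 5.8 (vii) p. 141] -/
def sumψAnMono : (w : V₁ ⊕ V₂) → {ν : LogVertex (Sum.elim isArc₁ isArc₂ w) // ν.IsCross} →
    (Lt₁.AnMono × Lt₂.AnMono ⥤ sumNmonoPlusCat Lt₁ Lt₂ w)
  | .inl w, ν => (Lt₁.ψAnMono w ν).prod Lt₂.κAnMono.inverse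
  | .inr w, ν => Lt₁.κAnMono.inverse.prod (Lt₂.ψAnMono w ν)

end Local

/-! ## §2. The sum of two settings -/

section Sum

variable {V₁ V₂ : Type u} {isArc₁ : V₁ → Bool} {isArc₂ : V₂ → Bool}
  (Lt₁ : LogFrobeniusSettingLtimes V₁ isArc₁) (Lt₂ : LogFrobeniusSettingLtimes V₂ isArc₂)

/-- ★ **The SUM of two log-Frobenius settings over the disjoint union of their index sets** (module docstring): global
categories the products, at each place its own factor's local row with the other factor carried as global data.
[cite: MochizukiAbsTopIII2015, Def 5.4 (ii) p. 125] -/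
def sum : LogFrobeniusSettingLtimes (V₁ ⊕ V₂) (Sum.elim isArc₁ isArc₂) where
  X := Lt₁.X × Lt₂.X
  E := Lt₁.E × Lt₂.E
  proj := Lt₁.proj.prod Lt₂.proj
  log := Lt₁.log.prod Lt₂.log
  logIsoId := NatIso.prod Lt₁.logIsoId Lt₂.logIsoId
  logOver := NatIso.prod Lt₁.logOver Lt₂.logOver
  Nplus v := sumNplusCat Lt₁ Lt₂ v
  N v := sumNCat Lt₁ Lt₂ v
  forget := sumForget Lt₁ Lt₂
  toE := sumToE Lt₁ Lt₂
  lam := sumLam Lt₁ Lt₂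
  lamOver := sumLamOver Lt₁ Lt₂
  lam_spaceLink_eq_postLog := sumLam_spaceLink_eq_postLog Lt₁ Lt₂
  iota v _ _ ε := sumIota Lt₁ Lt₂ v ε
  An := Lt₁.An × Lt₂.An
  κAn := Lt₁.κAn.prod Lt₂.κAn
  φAn := Lt₁.φAn.prod Lt₂.φAn
  φAn_isEquivalence :=
    haveI := Lt₁.φAn_isEquivalence
    haveI := Lt₂.φAn_isEquivalence
    (Lt₁.φAn.asEquivalence.prod Lt₂.φAn.asEquivalence).isEquivalence_functor
  ηAn := NatIso.prod Lt₁.ηAn Lt₂.ηAn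
  κAn₂ := Lt₁.κAn₂.prod Lt₂.κAn₂
  Emono := Lt₁.Emono × Lt₂.Emono
  monoAn := Lt₁.monoAn.prod Lt₂.monoAn
  NmonoPlus w := sumNmonoPlusCat Lt₁ Lt₂ w
  Nmono w := sumNmonoCat Lt₁ Lt₂ w
  forgetMono := sumForgetMono Lt₁ Lt₂
  toEmono := sumToEmono Lt₁ Lt₂
  monoNplus := sumMonoNplus Lt₁ Lt₂
  monoN := sumMonoN Lt₁ Lt₂
  monoHomotopy := sumMonoHomotopy Lt₁ Lt₂
  AnMono := Lt₁.AnMono × Lt₂.AnMono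
  κAnMono := Lt₁.κAnMono.prod Lt₂.κAnMono
  ψAnMono := sumψAnMono Lt₁ Lt₂

/-- `𝒳` of the sum is `𝒳₁ × 𝒳₂` (global). [cite: MochizukiAbsTopIII2015, Def 5.4 (ii) p. 125] -/
theorem sum_X : (Lt₁.sum Lt₂).X = (Lt₁.X × Lt₂.X) := rfl

/-- `ℰ⊢` and `An⊢` of the sum are the products (global). [cite: MochizukiAbsTopIII2015, Prop 5.8 (vii) p. 141] -/
theorem sum_Emono_AnMono : (Lt₁.sum Lt₂).Emono = (Lt₁.Emono × Lt₂.Emono) ∧ (Lt₁.sum Lt₂).AnMono = (Lt₁.AnMono × Lt₂.AnMono) :=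
  ⟨rfl, rfl⟩

/-- `λ⊞` at a place of the first index set: `λ₁ × 𝟭`. [cite: MochizukiAbsTopIII2015, Def 5.4 (iv) p. 127] -/
theorem sum_lam_inl (v : V₁) (ν : LogVertex (isArc₁ v)) :
    (Lt₁.sum Lt₂).lam (.inl v) ν = (Lt₁.lam v ν).prod (𝟭 Lt₂.X) := rfl

/-- `λ⊞` at a place of the second index set: `𝟭 × λ₂`. [cite: MochizukiAbsTopIII2015, Def 5.4 (iv) p. 127] -/
theorem sum_lam_inr (v : V₂) (ν : LogVertex (isArc₂ v)) :
    (Lt₁.sum Lt₂).lam (.inr v) ν = (𝟭 Lt₁.X).prod (Lt₂.lam v ν) := rfl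

/-- `ψ^{An⊢⊞}` at a place of the first index set: `ψ₁ × κ₂⁻¹`. [cite: MochizukiAbsTopIII2015, Prop 5.8 (vii) p. 141] -/
theorem sum_ψAnMono_inl (w : V₁) (ν : {ν : LogVertex (isArc₁ w) // ν.IsCross}) :
    (Lt₁.sum Lt₂).ψAnMono (.inl w) ν = (Lt₁.ψAnMono w ν).prod Lt₂.κAnMono.inverse := rfl

/-- `ψ^{An⊢⊞}` at a place of the second index set: `κ₁⁻¹ × ψ₂`. [cite: MochizukiAbsTopIII2015, Prop 5.8 (vii) p. 141] -/
theorem sum_ψAnMono_inr (w : V₂) (ν : {ν : LogVertex (isArc₂ w) // ν.IsCross}) :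
    (Lt₁.sum Lt₂).ψAnMono (.inr w) ν = Lt₁.κAnMono.inverse.prod (Lt₂.ψAnMono w ν) := rfl

/-- `ι⊞` at a place of the first index set, unfolded. [cite: MochizukiAbsTopIII2015, Def 5.4 (vii) p. 128] -/
theorem sum_iota_inl (v : V₁) {ν₁ ν₂ : LogVertex (isArc₁ v)} (ε : LogEdgeLtimes (isArc₁ v) ν₁ ν₂) :
    (Lt₁.sum Lt₂).iota (.inl v) ε =
      eqToHom (twist_comp_sumLam_inl Lt₁ Lt₂ ν₁.isPostLog v ν₁) ≫ NatTrans.prod (Lt₁.iota v ε) (Lt₂.twistToId ν₁.isPostLog) :=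
  rfl

/-- `ι⊞` at a place of the second index set, unfolded. [cite: MochizukiAbsTopIII2015, Def 5.4 (vii) p. 128] -/
theorem sum_iota_inr (v : V₂) {ν₁ ν₂ : LogVertex (isArc₂ v)} (ε : LogEdgeLtimes (isArc₂ v) ν₁ ν₂) :
    (Lt₁.sum Lt₂).iota (.inr v) ε =
      eqToHom (twist_comp_sumLam_inr Lt₁ Lt₂ ν₁.isPostLog v ν₁) ≫ NatTrans.prod (Lt₁.twistToId ν₁.isPostLog) (Lt₂.iota v ε) :=
  rfl

/-- The mono-analyticization of the sum is the product (global). [cite: MochizukiAbsTopIII2015, Def 5.6 (ii) p. 135] -/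
theorem sum_monoAn : (Lt₁.sum Lt₂).monoAn = Lt₁.monoAn.prod Lt₂.monoAn := rfl

/-- `monoNplus` at a place of the first index set: `monoNplus₁ × (proj₂ ⋙ monoAn₂)`. [cite: MochizukiAbsTopIII2015, Def 5.6 (iv) p. 136] -/
theorem sum_monoNplus_inl (v : V₁) : (Lt₁.sum Lt₂).monoNplus (.inl v) = (Lt₁.monoNplus v).prod (Lt₂.proj ⋙ Lt₂.monoAn) := rfl

/-- `monoNplus` at a place of the second index set. [cite: MochizukiAbsTopIII2015, Def 5.6 (iv) p. 136] -/
theorem sum_monoNplus_inr (v : V₂) : (Lt₁.sum Lt₂).monoNplus (.inr v) = (Lt₁.proj ⋙ Lt₁.monoAn).prod (Lt₂.monoNplus v) := rfl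

/-! ## §3. The add-ons of the sum from those of the factors -/

variable {Lt₁ Lt₂}

/-- abc-iut-L4-t3's `MonoAnalyticizationHomotopies` of the sum from those of the factors: rows 4→5 at `inl v` is
`M₁.toE v × (unitor)`, rows 6→7 is the product. [cite: MochizukiAbsTopIII2015, Cor 5.10 p. 146] -/
def sumMonoAnalyticizationHomotopies (M₁ : Lt₁.MonoAnalyticizationHomotopies) (M₂ : Lt₂.MonoAnalyticizationHomotopies) :
    (Lt₁.sum Lt₂).MonoAnalyticizationHomotopies where
  toE
    | .inl v => NatIso.prod (M₁.toE v) (Lt₂.proj ⋙ Lt₂.monoAn).rightUnitor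
    | .inr v => NatIso.prod (Lt₁.proj ⋙ Lt₁.monoAn).rightUnitor (M₂.toE v)
  anToE := NatIso.prod M₁.anToE M₂.anToE

/-- **Cor 5.10 (iv)(a) for the sum** (`V₁ ⊕ V₂ ≠ ∅`), from the factors' mono-analyticization homotopies.
[cite: MochizukiAbsTopIII2015, Cor 5.10 (iv)(a) p. 147] -/
theorem sum_cor510MonoCores [Nonempty (V₁ ⊕ V₂)] (M₁ : Lt₁.MonoAnalyticizationHomotopies)
    (M₂ : Lt₂.MonoAnalyticizationHomotopies) : (Lt₁.sum Lt₂).Cor510MonoCores :=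
  cor510MonoCores_holds (sumMonoAnalyticizationHomotopies M₁ M₂)

/-- The `hψ` of the sum: "`ψ` lies over `ℰ⊢`" at `inl w` is `hψ₁ × 𝟙` (the carried factor `κ₂⁻¹ ⋙ 𝟭 ⋙ 𝟭` IS `κ₂⁻¹`).
[cite: MochizukiAbsTopIII2015, Definition 5.6 (iv) p. 136] -/
def sumψOverIso
    (hψ₁ : ∀ (w : V₁) (j : {ν : LogVertex (isArc₁ w) // ν.IsCross}),
      Lt₁.ψAnMono w j ⋙ Lt₁.forgetMono w ⋙ Lt₁.toEmono w ≅ Lt₁.κAnMono.inverse)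
    (hψ₂ : ∀ (w : V₂) (j : {ν : LogVertex (isArc₂ w) // ν.IsCross}),
      Lt₂.ψAnMono w j ⋙ Lt₂.forgetMono w ⋙ Lt₂.toEmono w ≅ Lt₂.κAnMono.inverse) :
    ∀ (w : V₁ ⊕ V₂) (j : {ν : LogVertex (Sum.elim isArc₁ isArc₂ w) // ν.IsCross}),
      (Lt₁.sum Lt₂).ψAnMono w j ⋙ (Lt₁.sum Lt₂).forgetMono w ⋙ (Lt₁.sum Lt₂).toEmono w ≅ (Lt₁.sum Lt₂).κAnMono.inverse
  | .inl w, j => NatIso.prod (hψ₁ w j) (Iso.refl Lt₂.κAnMono.inverse)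
  | .inr w, j => NatIso.prod (Iso.refl Lt₁.κAnMono.inverse) (hψ₂ w j)

/-- The second component of the sum's `hψ` at `inl w` is the identity on objects. [cite: MochizukiAbsTopIII2015, Definition 5.6 (iv) p. 136] -/
theorem sumψOverIso_inl_hom_app_snd
    (hψ₁ : ∀ (w : V₁) (j : {ν : LogVertex (isArc₁ w) // ν.IsCross}),
      Lt₁.ψAnMono w j ⋙ Lt₁.forgetMono w ⋙ Lt₁.toEmono w ≅ Lt₁.κAnMono.inverse)
    (hψ₂ : ∀ (w : V₂) (j : {ν : LogVertex (isArc₂ w) // ν.IsCross}),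
      Lt₂.ψAnMono w j ⋙ Lt₂.forgetMono w ⋙ Lt₂.toEmono w ≅ Lt₂.κAnMono.inverse)
    (w : V₁) (j : {ν : LogVertex (isArc₁ w) // ν.IsCross}) (X : Lt₁.AnMono × Lt₂.AnMono) :
    ((sumψOverIso hψ₁ hψ₂ (.inl w) j).hom.app X).2 = 𝟙 (Lt₂.κAnMono.inverse.obj X.2) := rfl

/-- … and at `inr w` the first component is. [cite: MochizukiAbsTopIII2015, Definition 5.6 (iv) p. 136] -/
theorem sumψOverIso_inr_hom_app_fst
    (hψ₁ : ∀ (w : V₁) (j : {ν : LogVertex (isArc₁ w) // ν.IsCross}),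
      Lt₁.ψAnMono w j ⋙ Lt₁.forgetMono w ⋙ Lt₁.toEmono w ≅ Lt₁.κAnMono.inverse)
    (hψ₂ : ∀ (w : V₂) (j : {ν : LogVertex (isArc₂ w) // ν.IsCross}),
      Lt₂.ψAnMono w j ⋙ Lt₂.forgetMono w ⋙ Lt₂.toEmono w ≅ Lt₂.κAnMono.inverse)
    (w : V₂) (j : {ν : LogVertex (isArc₂ w) // ν.IsCross}) (X : Lt₁.AnMono × Lt₂.AnMono) :
    ((sumψOverIso hψ₁ hψ₂ (.inr w) j).hom.app X).1 = 𝟙 (Lt₁.κAnMono.inverse.obj X.1) := rfl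

section Iota

variable {hψ₁ : ∀ (w : V₁) (j : {ν : LogVertex (isArc₁ w) // ν.IsCross}),
    Lt₁.ψAnMono w j ⋙ Lt₁.forgetMono w ⋙ Lt₁.toEmono w ≅ Lt₁.κAnMono.inverse}
  {hψ₂ : ∀ (w : V₂) (j : {ν : LogVertex (isArc₂ w) // ν.IsCross}),
    Lt₂.ψAnMono w j ⋙ Lt₂.forgetMono w ⋙ Lt₂.toEmono w ≅ Lt₂.κAnMono.inverse}
  (I₁ : Lt₁.IotaAnMono hψ₁) (I₂ : Lt₂.IotaAnMono hψ₂)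

/-- `ι^{An⊢⊞}_{w,ε}` of the sum: `ι₁ × 𝟙` at `inl w`, `𝟙 × ι₂` at `inr w`. [cite: MochizukiAbsTopIII2015, Prop 5.8 (vii) p. 142] -/
def sumIotaι : (w : V₁ ⊕ V₂) → {ν₁ ν₂ : LogVertex (Sum.elim isArc₁ isArc₂ w)} →
    (ε : LogEdgeTS (Sum.elim isArc₁ isArc₂ w) ν₁ ν₂) → (hε : ε.InCore) →
    ((Lt₁.sum Lt₂).ψAnMono w ⟨ν₁, hε.isCross_src⟩ ⟶ (Lt₁.sum Lt₂).ψAnMono w ⟨ν₂, hε.isCross_tgt⟩)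
  | .inl w, _, _, ε, hε => NatTrans.prod (I₁.ι w ε hε) (𝟙 Lt₂.κAnMono.inverse)
  | .inr w, _, _, ε, hε => NatTrans.prod (𝟙 Lt₁.κAnMono.inverse) (I₂.ι w ε hε)

/-- It lies over the identity of `Th⊢[Z] = ℰ⊢₁ × ℰ⊢₂` (componentwise: `ι_over` of the factor, identity on the carried object).
[cite: MochizukiAbsTopIII2015, Prop 5.8 (vii) p. 142] -/
theorem sumIotaι_over : ∀ (w : V₁ ⊕ V₂) {ν₁ ν₂ : LogVertex (Sum.elim isArc₁ isArc₂ w)}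
    (ε : LogEdgeTS (Sum.elim isArc₁ isArc₂ w) ν₁ ν₂) (hε : ε.InCore) (X : (Lt₁.sum Lt₂).AnMono),
    ((Lt₁.sum Lt₂).toEmono w).map (((Lt₁.sum Lt₂).forgetMono w).map ((sumIotaι I₁ I₂ w ε hε).app X)) =
      (sumψOverIso hψ₁ hψ₂ w ⟨ν₁, hε.isCross_src⟩).hom.app X ≫ (sumψOverIso hψ₁ hψ₂ w ⟨ν₂, hε.isCross_tgt⟩).inv.app X
  | .inl w, _, _, ε, hε, X => Prod.ext (I₁.ι_over w ε hε X.1) (Category.id_comp _).symm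
  | .inr w, _, _, ε, hε, X => Prod.ext (Category.id_comp _).symm (I₂.ι_over w ε hε X.2)

/-- ★ **abc-iut-L4-t3's add-on `ι^{An⊢⊞}` is inherited by the sum**: `ι₁ × 𝟙` at `inl w`, `𝟙 × ι₂` at `inr w` (each place reads
its own factor's GENUINE `ι^{An⊢⊞}`; "over `Th⊢[Z]`" componentwise). [cite: MochizukiAbsTopIII2015, Prop 5.8 (vii) p. 142] -/
def sumIotaAnMono : (Lt₁.sum Lt₂).IotaAnMono (sumψOverIso hψ₁ hψ₂) where
  ι := sumIotaι I₁ I₂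
  ι_over := sumIotaι_over I₁ I₂

/-- `ι^{An⊢⊞}` of the sum at `inl w`, unfolded. [cite: MochizukiAbsTopIII2015, Prop 5.8 (vii) p. 142] -/
theorem sumIotaAnMono_ι_inl (w : V₁) {ν₁ ν₂ : LogVertex (isArc₁ w)} (ε : LogEdgeTS (isArc₁ w) ν₁ ν₂) (hε : ε.InCore) :
    (sumIotaAnMono I₁ I₂).ι (.inl w) ε hε = NatTrans.prod (I₁.ι w ε hε) (𝟙 Lt₂.κAnMono.inverse) := rfl

/-- `ι^{An⊢⊞}` of the sum at `inr w`, unfolded. [cite: MochizukiAbsTopIII2015, Prop 5.8 (vii) p. 142] -/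
theorem sumIotaAnMono_ι_inr (w : V₂) {ν₁ ν₂ : LogVertex (isArc₂ w)} (ε : LogEdgeTS (isArc₂ w) ν₁ ν₂) (hε : ε.InCore) :
    (sumIotaAnMono I₁ I₂).ι (.inr w) ε hε = NatTrans.prod (𝟙 Lt₁.κAnMono.inverse) (I₂.ι w ε hε) := rfl

end Iota

end Sum

end LogFrobeniusSettingLtimes

end Literature.AnabelianGeometry.AbsoluteAnabelian

end
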